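import Summits.CriticalPhenomena.PercolationContinuityZ3.Theorems.Transplant.SqShadowBlocks
import Summits.CriticalPhenomena.PercolationContinuityZ3.Theorems.Transplant.SqShadowVRouteData
import HarnessLib

/-!
# SQUARE SHADOWS — the cleared blocks of the local surgery at a GENERAL RADIUS `R` (square twin of «HexShadowBlocksR»)

builds on p205010 (kernel theorem, internal audit signed; external expert review pending) — NOT used in this file.  Lane `prim-bschramm`, seat `prim-bschramm-p2` (gen 42; class C1b;
memo `HOME/bschramm/P2-LATTICES.md` §148); helper file (`--supports stmt-CriticalPhenomena-4575 --as helper`).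
«SqShadowBlocks» VERBATIM with DST's surgery radius a parameter `R` (blocks `sqBlkR R` of «SqShadowVRouteData»): the cleared block **`DblkR R Γ z = sqBall z R ∩ {ξ ≤ 3m} ∩
{η ≤ 3m + (P·s − 2m)⁺}`**, the rerouting block **`RPblkR R Γ z`** (one column less when `Z_n` meets `sqBall z R`), the exceptional sets `X₁R`, `X₂R`, `zBadR`; the inclusions the
surgery needs at scale `m ≥ 4R + 1` (`RPblkR ⊆ DblkR ⊆ sqBall z R`, `DblkR ⊆ big ∪ small` off `X₁R`, `RPblkR ⊆ big`, `RPblkR ∩ Z_n = ∅` off `zBadR`, `sqBall z R ∩ (big ∪ small) ⊆ DblkR`,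
`DblkR ∩ S_{3n} = ∅`, "clipped in at most one direction" off `X₂R`), and the boundedness of the exceptional sets.  The thin films (`D_4`, `D_6`) need `R = 4`: see the memo §148.
[cite: DuminilCopinSidoraviciusTassion2016, §2.3 (proof of Fact 2: "Fix R ≥ 2 …", the balls B_R(z), B_{R+1}(z))]
-/

noncomputable section

namespace Summit.CriticalPhenomena.PercolationContinuityZ3.Theorems.Transplant

open MeasureTheory Literature.Probability.Percolation Literature.Probability.LatticeModels SimpleGraph Filter
open scoped Classical Topology

/-! ## §1 The blocks of radius `R` -/

/-- Membership in a clipped square block of radius `R`, in linear form. [folklore] -/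
theorem mem_sqBlkR_iff_lin {R : ℕ} {z : Site 2} {t s : ℕ} {w : Site 2} :
    w ∈ sqBlkR R z t s ↔ ((-(R : ℤ) ≤ w 0 - z 0 ∧ w 0 - z 0 ≤ R) ∧ (-(R : ℤ) ≤ w 1 - z 1 ∧ w 1 - z 1 ≤ R)) ∧ w 0 ≤ z 0 + t ∧ w 1 ≤ z 1 + s := by
  rw [mem_sqBlkR, mem_sqBall_iff_linear]; omega

/-- Monotonicity of clipped blocks in the clip parameters. [folklore] -/
theorem sqBlkR_mono (R : ℕ) (z : Site 2) {t t' s s' : ℕ} (ht : t ≤ t') (hs : s ≤ s') : sqBlkR R z t s ⊆ sqBlkR R z t' s' := by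
  intro w hw
  rw [mem_sqBlkR] at hw ⊢
  exact ⟨hw.1, hw.2.1.trans (by omega), hw.2.2.trans (by omega)⟩

/-- A clipped block lies in the square of radius `R`. [folklore] -/
theorem sqBlkR_subset_sqBall (R : ℕ) (z : Site 2) (t s : ℕ) : sqBlkR R z t s ⊆ sqBall z R := fun _ hw => hw.1

namespace SqShadow

variable {V : Type} {G : SimpleGraph V} (Ψ : SqShadow G)

/-- `Z_n` meets `sqBall z R`. [folklore] -/
def zTouchR (R : ℕ) (Γ : GlueData) (z : Site 2) : Prop := ∃ w ∈ sqBall z R, w ∈ Ψ.zSeg Γ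

/-- The `ξ`-clip parameter of the rerouting block of radius `R`: one less than that of the cleared block when `Z_n` meets `sqBall z R`. [cite: DuminilCopinSidoraviciusTassion2016, §2.3, proof of Fact 2] -/
def tRR (R : ℕ) (Γ : GlueData) (z : Site 2) : ℕ := if Ψ.zTouchR R Γ z then Ψ.tD Γ z - 1 else Ψ.tD Γ z

/-- **The cleared block `D(z)` of radius `R`**, clipped to the window. [cite: DuminilCopinSidoraviciusTassion2016, §2.3, proof of Fact 2 (the ball B_R(z))] -/
def DblkR (R : ℕ) (Γ : GlueData) (z : Site 2) : Set (Site 2) := sqBlkR R z (Ψ.tD Γ z) (Ψ.sD Γ z)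

/-- **The rerouting block `RP(z)` of radius `R`**: the part of `D(z)` in `B_{3n}`, minus the column line of `Z_n` when `Z_n` meets the square.
[cite: DuminilCopinSidoraviciusTassion2016, §2.3, proof of Fact 2] -/
def RPblkR (R : ℕ) (Γ : GlueData) (z : Site 2) : Set (Site 2) := sqBlkR R z (Ψ.tRR R Γ z) (Ψ.sR Γ z)

/-- The exceptional points near the top-left inner corner of the window, radius `R`. [folklore] -/
def X₁R (R : ℕ) (Γ : GlueData) : Set (Site 2) := {z | z 0 ≤ Ψ.centre 0 + Γ.m + (R - 1 : ℕ) ∧ Ψ.centre 1 + 3 * Γ.m - (R - 1 : ℕ) ≤ z 1}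

/-- The exceptional points near the top-right corner `c + (3m, 3m)` of `B_{3n}`, radius `R`. [folklore] -/
def X₂R (R : ℕ) (Γ : GlueData) : Set (Site 2) := {z | Ψ.centre 0 + 3 * Γ.m - (R + 1) ≤ z 0 ∧ Ψ.centre 1 + 3 * Γ.m - (R + 1) ≤ z 1}

/-- The exceptional points whose square of radius `R` is cut PARTIALLY by `Z_n`. [folklore] -/
def zBadR (R : ℕ) (Γ : GlueData) : Set (Site 2) := {z | Ψ.zTouchR R Γ z ∧ ∃ w ∈ sqBall z R, w 0 = Ψ.centre 0 + 3 * Γ.m ∧ w ∉ Ψ.zSeg Γ}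

/-- At radius `3` these are the objects of «SqShadowBlocks». [folklore] -/
theorem zTouchR_three : Ψ.zTouchR 3 = Ψ.zTouch := rfl

/-- At radius `3` these are the objects of «SqShadowBlocks». [folklore] -/
theorem tRR_three : Ψ.tRR 3 = Ψ.tR := rfl

/-- At radius `3` these are the objects of «SqShadowBlocks». [folklore] -/
theorem DblkR_three : Ψ.DblkR 3 = Ψ.Dblk := rfl

/-- At radius `3` these are the objects of «SqShadowBlocks». [folklore] -/
theorem RPblkR_three : Ψ.RPblkR 3 = Ψ.RPblk := rfl

/-- At radius `3` these are the objects of «SqShadowBlocks». [folklore] -/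
theorem zBadR_three : Ψ.zBadR 3 = Ψ.zBad := rfl

/-! ## §2 The inclusions -/

variable {Ψ}

/-- `RP(z) ⊆ D(z)`. [folklore] -/
theorem RPblkR_subset_DblkR (R : ℕ) (Γ : GlueData) (z : Site 2) : Ψ.RPblkR R Γ z ⊆ Ψ.DblkR R Γ z := by
  refine sqBlkR_mono R z ?_ ?_
  · unfold tRR; split_ifs <;> omega
  · unfold sR sD
    have : (0 : ℤ) ≤ max (Ψ.period * Γ.s - 2 * Γ.m) 0 := le_max_right _ _
    omega

/-- The clip parameters of `RP(z)` are at most those of `D(z)`. [folklore] -/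
theorem tRR_le_tD (R : ℕ) (Γ : GlueData) (z : Site 2) : Ψ.tRR R Γ z ≤ Ψ.tD Γ z ∧ Ψ.sR Γ z ≤ Ψ.sD Γ z := by
  refine ⟨?_, (tR_le_tD Γ z).2⟩
  unfold tRR; split_ifs <;> omega

/-- `D(z) ⊆ sqBall z R`. [folklore] -/
theorem DblkR_subset_sqBall (R : ℕ) (Γ : GlueData) (z : Site 2) : Ψ.DblkR R Γ z ⊆ sqBall z R := sqBlkR_subset_sqBall _ _ _ _

/-- **`sqBall z R ∩ B_{3n} ⊆ D(z)`.** [folklore] -/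
theorem sqBall_inter_big_subset_DblkR {R : ℕ} (Γ : GlueData) (z : Site 2) {w : Site 2} (hw : w ∈ sqBall z R) (hwb : w ∈ Ψ.big Γ) :
    w ∈ Ψ.DblkR R Γ z := by
  rw [mem_big_iff] at hwb
  refine ⟨hw, ?_, ?_⟩
  · unfold tD; omega
  · unfold sD
    have : (0 : ℤ) ≤ max (Ψ.period * Γ.s - 2 * Γ.m) 0 := le_max_right _ _
    omega

/-- **`sqBall z R ∩ B'_n ⊆ D(z)`.** [folklore] -/
theorem sqBall_inter_small_subset_DblkR {R : ℕ} (Γ : GlueData) (z : Site 2) {w : Site 2} (hw : w ∈ sqBall z R) (hws : w ∈ Ψ.small Γ) :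
    w ∈ Ψ.DblkR R Γ z := by
  rw [mem_small_iff] at hws
  refine ⟨hw, ?_, ?_⟩
  · unfold tD; omega
  · unfold sD
    have : Ψ.period * Γ.s - 2 * Γ.m ≤ max (Ψ.period * Γ.s - 2 * Γ.m) 0 := le_max_left _ _
    omega

/-- **`RP(z) ⊆ B_{3n}`** for `z ∈ big ∩ small`, `m ≥ 4R + 1`. [folklore] -/
theorem RPblkR_subset_big {R : ℕ} {Γ : GlueData} (hΓ : Ψ.InRange Γ) (hm : 4 * R + 1 ≤ Γ.m) {z : Site 2} (hzb : z ∈ Ψ.big Γ) (hzs : z ∈ Ψ.small Γ) :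
    Ψ.RPblkR R Γ z ⊆ Ψ.big Γ := by
  intro w hw
  obtain ⟨-, -, -, -, -, hs1, hs2⟩ := hΓ
  rw [RPblkR, mem_sqBlkR_iff_lin] at hw
  rw [mem_big_iff] at hzb ⊢
  rw [mem_small_iff] at hzs
  have htR : (Ψ.tRR R Γ z : ℤ) ≤ Ψ.centre 0 + 3 * Γ.m - z 0 := by
    have h1 : Ψ.tRR R Γ z ≤ Ψ.tD Γ z := (tRR_le_tD R Γ z).1
    have h2 : ((Ψ.tD Γ z : ℕ) : ℤ) = Ψ.centre 0 + 3 * Γ.m - z 0 := by unfold tD; omega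
    omega
  have hsR : ((Ψ.sR Γ z : ℕ) : ℤ) = Ψ.centre 1 + 3 * Γ.m - z 1 := by unfold sR; omega
  omega

/-- **`D(z) ⊆ B_{3n} ∪ B'_n`** for `z ∈ big ∩ small` off `X₁R`, `m ≥ 4R + 1`. [cite: DuminilCopinSidoraviciusTassion2016, §2.3, proof of Fact 2 (B_{R+1}(z) inside B_{3n} ∪ B'_n)] -/
theorem DblkR_subset_window {R : ℕ} {Γ : GlueData} (hΓ : Ψ.InRange Γ) (hm : 4 * R + 1 ≤ Γ.m) {z : Site 2} (hzb : z ∈ Ψ.big Γ) (hzs : z ∈ Ψ.small Γ)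
    (hX : z ∉ Ψ.X₁R R Γ) : Ψ.DblkR R Γ z ⊆ Ψ.big Γ ∪ Ψ.small Γ := by
  intro w hw
  obtain ⟨-, -, -, -, -, hs1, hs2⟩ := hΓ
  rw [DblkR, mem_sqBlkR_iff_lin] at hw
  simp only [X₁R, Set.mem_setOf_eq, not_and_or, not_le] at hX
  rw [Set.mem_union, mem_big_iff, mem_small_iff]
  rw [mem_big_iff] at hzb
  rw [mem_small_iff] at hzs
  have hR1 : ((R - 1 : ℕ) : ℤ) ≥ (R : ℤ) - 1 := by omega
  have htD : ((Ψ.tD Γ z : ℕ) : ℤ) = Ψ.centre 0 + 3 * Γ.m - z 0 := by unfold tD; omega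
  have hsD : ((Ψ.sD Γ z : ℕ) : ℤ) = Ψ.centre 1 + 3 * Γ.m + max (Ψ.period * Γ.s - 2 * Γ.m) 0 - z 1 := by
    unfold sD
    have : (0 : ℤ) ≤ max (Ψ.period * Γ.s - 2 * Γ.m) 0 := le_max_right _ _
    omega
  by_cases hη : w 1 - Ψ.centre 1 ≤ 3 * Γ.m
  · left; omega
  · right
    have hmax : max (Ψ.period * Γ.s - 2 * Γ.m) 0 = Ψ.period * Γ.s - 2 * Γ.m := by
      rcases le_or_gt (Ψ.period * Γ.s - 2 * Γ.m) 0 with h | h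
      · exfalso; rw [max_eq_right h] at hsD; omega
      · exact max_eq_left h.le
    rw [hmax] at hsD
    omega

/-- **`RP(z)` misses `Z_n`** for `z ∈ B_{3n} ∖ Z_n` off `zBadR`. [folklore] -/
theorem RPblkR_disjoint_zSeg {R : ℕ} {Γ : GlueData} {z : Site 2} (hzbig : z ∈ Ψ.big Γ) (hzZ : z ∉ Ψ.zSeg Γ) (hzb : z ∉ Ψ.zBadR R Γ) {w : Site 2}
    (hw : w ∈ Ψ.RPblkR R Γ z) : w ∉ Ψ.zSeg Γ := by
  intro hwZ
  have htouch : Ψ.zTouchR R Γ z := ⟨w, sqBlkR_subset_sqBall _ _ _ _ hw, hwZ⟩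
  have hall : ∀ w' ∈ sqBall z R, w' 0 = Ψ.centre 0 + 3 * Γ.m → w' ∈ Ψ.zSeg Γ := by
    intro w' hw' h0
    by_contra hnot
    exact hzb ⟨htouch, w', hw', h0, hnot⟩
  have htR : Ψ.tRR R Γ z = Ψ.tD Γ z - 1 := by simp [tRR, htouch]
  rw [RPblkR, mem_sqBlkR_iff_lin, htR] at hw
  rw [mem_zSeg_iff] at hwZ
  rw [mem_big_iff] at hzbig
  rcases Nat.eq_zero_or_pos (Ψ.tD Γ z) with h0 | hpos
  · have hz0 : z 0 = Ψ.centre 0 + 3 * Γ.m := by unfold tD at h0; omega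
    exact hzZ (hall z (centre_mem_sqBall z R) hz0)
  · have : ((Ψ.tD Γ z - 1 : ℕ) : ℤ) = Ψ.centre 0 + 3 * Γ.m - z 0 - 1 := by unfold tD at hpos ⊢; omega
    omega

/-- **`D(z)` misses `S_{3n}`** for `z ∈ B'_n`, `m ≥ 4R + 1` (`dist(B'_n, S_{3n}) ≥ m − 3m/4 > R`). [folklore] -/
theorem DblkR_disjoint_src {R : ℕ} {Γ : GlueData} (hΓ : Ψ.InRange Γ) (hm : 4 * R + 1 ≤ Γ.m) {z : Site 2} (hzs : z ∈ Ψ.small Γ) {w : Site 2}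
    (hw : w ∈ Ψ.DblkR R Γ z) : w ∉ Ψ.src Γ := by
  intro hws
  obtain ⟨-, hu₃, -, -, -, hs1, hs2⟩ := hΓ
  rw [DblkR, mem_sqBlkR_iff_lin] at hw
  rw [mem_small_iff] at hzs
  rw [mem_src_iff] at hws
  omega

/-- **Off `X₂R`, the blocks are clipped in at most one direction.** [folklore] -/
theorem le_tRR_or_sR {R : ℕ} {Γ : GlueData} {z : Site 2} (hX : z ∉ Ψ.X₂R R Γ) : R ≤ Ψ.tRR R Γ z ∨ R ≤ Ψ.sR Γ z := by
  simp only [X₂R, Set.mem_setOf_eq, not_and_or, not_le] at hX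
  rcases hX with h | h
  · left
    have : R + 1 ≤ Ψ.tD Γ z := by unfold tD; omega
    unfold tRR; split_ifs <;> omega
  · right; unfold sR; omega

/-- **A point of `D(z) ∩ B_{3n}` off `Z_n` lies in `RP(z)`** (for `z ∈ B_{3n} ∖ Z_n` off `zBadR`). [folklore] -/
theorem mem_RPblkR_of {R : ℕ} {Γ : GlueData} {z : Site 2} (hzbig : z ∈ Ψ.big Γ) (hzZ : z ∉ Ψ.zSeg Γ) (hzb : z ∉ Ψ.zBadR R Γ) {w : Site 2}
    (hwD : w ∈ Ψ.DblkR R Γ z) (hwbig : w ∈ Ψ.big Γ) (hwZ : w ∉ Ψ.zSeg Γ) : w ∈ Ψ.RPblkR R Γ z := by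
  have hwR : w ∈ sqBall z R := DblkR_subset_sqBall R Γ z hwD
  rw [DblkR, mem_sqBlkR_iff_lin] at hwD
  rw [RPblkR, mem_sqBlkR_iff_lin]
  rw [mem_big_iff] at hwbig hzbig
  refine ⟨hwD.1, ?_, by unfold sR; omega⟩
  have htD : ((Ψ.tD Γ z : ℕ) : ℤ) = Ψ.centre 0 + 3 * Γ.m - z 0 := by unfold tD; omega
  by_cases ht : Ψ.zTouchR R Γ z
  · have htR : Ψ.tRR R Γ z = Ψ.tD Γ z - 1 := by simp [tRR, ht]
    rw [htR]
    have hall : ∀ w' ∈ sqBall z R, w' 0 = Ψ.centre 0 + 3 * Γ.m → w' ∈ Ψ.zSeg Γ := by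
      intro w' hw' h0; by_contra hnot; exact hzb ⟨ht, w', hw', h0, hnot⟩
    have hw0 : w 0 ≠ Ψ.centre 0 + 3 * Γ.m := fun h0 => hwZ (hall w hwR h0)
    have hz0 : z 0 ≠ Ψ.centre 0 + 3 * Γ.m := fun h0 => hzZ (hall z (centre_mem_sqBall z R) h0)
    have hpos : 1 ≤ Ψ.tD Γ z := by omega
    have : ((Ψ.tD Γ z - 1 : ℕ) : ℤ) = Ψ.centre 0 + 3 * Γ.m - z 0 - 1 := by omega
    omega
  · have htR : Ψ.tRR R Γ z = Ψ.tD Γ z := by simp [tRR, ht]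
    rw [htR]; omega

/-! ## §3 The exceptional sets are bounded -/

/-- `X₁R ∩ big ∩ small` lies in the square of radius `R` about the point `c + (m, 3m)`. [folklore] -/
theorem X₁R_subset {R : ℕ} {Γ : GlueData} {z : Site 2} (hz : z ∈ Ψ.X₁R R Γ) (hzb : z ∈ Ψ.big Γ) (hzs : z ∈ Ψ.small Γ) :
    z ∈ sqBall (Ψ.centre + ![(Γ.m : ℤ), 3 * Γ.m]) R := by
  simp only [X₁R, Set.mem_setOf_eq] at hz
  rw [mem_big_iff] at hzb
  rw [mem_small_iff] at hzs
  rw [mem_sqBall_iff_linear]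
  simp only [Pi.add_apply, Matrix.cons_val_zero, Matrix.cons_val_one]
  have : ((R - 1 : ℕ) : ℤ) ≤ R := by omega
  omega

/-- `X₂R` (within `big`) lies in the square of radius `R + 1` about the corner `c + (3m, 3m)` of `big`. [folklore] -/
theorem X₂R_subset {R : ℕ} {Γ : GlueData} {z : Site 2} (hz : z ∈ Ψ.X₂R R Γ) (hzb : z ∈ Ψ.big Γ) :
    z ∈ sqBall (Ψ.centre + ![3 * (Γ.m : ℤ), 3 * Γ.m]) (R + 1) := by
  simp only [X₂R, Set.mem_setOf_eq] at hz
  rw [mem_big_iff] at hzb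
  rw [mem_sqBall_iff_linear]
  simp only [Pi.add_apply, Matrix.cons_val_zero, Matrix.cons_val_one]
  push_cast
  omega

/-- `zBadR` lies in the two squares of radius `4R` about the ends `c + (3m, P·s ∓ a)` of `Z_n`. [folklore] -/
theorem zBadR_subset {R : ℕ} {Γ : GlueData} {z : Site 2} (hz : z ∈ Ψ.zBadR R Γ) :
    z ∈ sqBall (Ψ.centre + ![3 * (Γ.m : ℤ), Ψ.period * Γ.s - Γ.a]) (4 * R) ∨ z ∈ sqBall (Ψ.centre + ![3 * (Γ.m : ℤ), Ψ.period * Γ.s + Γ.a]) (4 * R) := by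
  obtain ⟨⟨w, hw, hwZ⟩, w', hw', hw'0, hw'Z⟩ := hz
  rw [mem_zSeg_iff] at hwZ hw'Z
  rw [mem_sqBall_iff_linear] at hw hw'
  simp only [not_and_or, not_le] at hw'Z
  rw [mem_sqBall_iff_linear, mem_sqBall_iff_linear]
  simp only [Pi.add_apply, Matrix.cons_val_zero, Matrix.cons_val_one]
  push_cast
  rcases hw'Z with h | h | h
  · exact absurd hw'0 h
  · left; omega
  · right; omega

end SqShadow

end Summit.CriticalPhenomena.PercolationContinuityZ3.Theorems.Transplant

end
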